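import Summits.MatrixMultiplication.MatrixMultiplication.Theorems.AbelianSTPPCensusTB5StatSplit

/-!
# T_B static certificate, range `5995 … 6012` (multi-parameter k-member tree at `τ = 2375/1000`): kernel pieces of the cell `(14, 16, 16)` (volume `3584`) at the order `5997`, part 1/1

Cell mm-stpp (rung F-M1), tier T_B = «beat `2.375` (Coppersmith–Winograd)»; seat mm-stpp-vp-p2 (gen 7).  Root-split layout (`AbelianSTPPCensusTAStatKMemberXSplit.lean`, `…XWalk.lean`, `AbelianSTPPCensusTB5StatSplit.lean`): the (cell, order) tree has
47470 nodes — beyond one `decide` — and is cut along list positions into `goIR` pieces / small subtrees / descent children of ≤ 4·10⁴ nodes each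
(this file: 3 pieces, 47470 nodes; sizes from the exact twin seat twin/tastat9.py, kit j314356), assembled in `AbelianSTPPCensusTB5StatCkS5997.lean`.
`decide` with kernel reduction (standard axioms; no `native_decide`), `Elab.async false`.
WHAT THIS IS NOT: arithmetic on shape lists only; no statement about STPP families or `ω`.
-/

set_option linter.dupNamespace false
set_option autoImplicit false
set_option Elab.async false

namespace Summit.MatrixMultiplication.MatrixMultiplication.Theorems.TB5Stat

open ShapeCert (gainOfTBV)
open TECert (vol)

set_option maxHeartbeats 0 in
/-- root positions `0 … 0` (bucket `70`, order `5997`): 13889 nodes [original] -/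
theorem s5997b70rg0 : TAStatKM.goIR gainOfTBV 3584 (fun A' ms' => TAStatKM.treeKX tb m2l gainOfTBV (rowOf 3584) (xrowOf 3584) (gainOfTBV 3584) 704 3584 1362 14 224 5997 kmax 81 A' 70 ms') TAStatKM.agg0 (m2l 70) 0 1 = true := by decide +kernel

set_option maxHeartbeats 0 in
/-- root positions `1 … 101` (bucket `70`, order `5997`): 32389 nodes [original] -/
theorem s5997b70rg1 : TAStatKM.goIR gainOfTBV 3584 (fun A' ms' => TAStatKM.treeKX tb m2l gainOfTBV (rowOf 3584) (xrowOf 3584) (gainOfTBV 3584) 704 3584 1362 14 224 5997 kmax 81 A' 70 ms') TAStatKM.agg0 (m2l 70) 1 101 = true := by decide +kernel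

set_option maxHeartbeats 0 in
/-- root descent child to bucket `69` (1192 nodes) [original] -/
theorem s5997b70rd : TAStatKM.treeKX tb m2l gainOfTBV (rowOf 3584) (xrowOf 3584) (gainOfTBV 3584) 704 3584 1362 14 224 5997 kmax 81 TAStatKM.agg0 69 (m2l 69) = true := by decide +kernel

end Summit.MatrixMultiplication.MatrixMultiplication.Theorems.TB5Stat
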